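import Summits.KontsevichZagierPeriods.KontsevichZagierPeriods.Theses.SymplecticScissors
import Summits.KontsevichZagierPeriods.KontsevichZagierPeriods.Theorems.PlanarK0Injective.Negative.Kit
import Summits.KontsevichZagierPeriods.KontsevichZagierPeriods.Theorems.SymplecticScissorsFiniteMapShear
import Literature.NumberTheory.Transcendental.KZSemialgebraicComplex
import Literature.NumberTheory.Transcendental.KZSemiCanonicalReductionProofs

/-!
# `PlanarK0Injective` (stmt-KontsevichZagierPeriods-9847) — line `mordell-weil-normal-form`,
stub `stub_arctanCellLaw` (rung 0 of the normal form: the addition law of arctangent cells)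

For real algebraic `β, γ > 0` with `βγ < 1` write `A(x) = {0 < u < x, 0 < v, (1 + u²) v < 1}` for
the arctangent cell (area `arctan x`) and `β ⊕ γ = (β + γ)/(1 − βγ)` (so that
`arctan (β ⊕ γ) = arctan β + arctan γ`). **The addition theorem of `arctan` is planar
cut-and-paste**: `[A(β ⊕ γ)] − [A(β)] − [A(γ)]` lies in the planar set-chain group, by one vertical
cut of `A(β ⊕ γ)` at `u = β` (rule 1a, plus the null segment `u = β`) and ONE rule-2 move, the
Möbius shear `(u, v) ↦ (M u, v / M′ u)` with `M u = (u − β)/(1 + βu)` (the rotation of the circle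
by `−arctan β`; `dθ = du/(1 + u²)` is `M`-invariant: `M′ u /(1 + (M u)²) = 1/(1 + u²)`), an
instance of the landed support `FiniteMapShear`, carrying `{β < u < β ⊕ γ, …}` onto `A(γ)`. This is
the circle part of the multiplicative relations of the toric normal basis of the line (card
`Ideas/mordell-weil-normal-form.md`, rung 0), used by `stub_mordellWeilNormalForm`.

Sources: Kontsevich–Zagier 2001, §1.1–1.2 (rules (1a), (2); `π = ∫ dx/(1+x²)`).
-/

noncomputable section

open MeasureTheory Set MvPolynomial
open Literature.NumberTheory.Transcendental Literature.ModelTheory.ExponentialFields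
open Summit.KontsevichZagierPeriods.SymplecticScissors.PlanarK0InjectiveNegative (planarGroup
  planarGens of_mem_planarGroup_of_volume_eq_zero)
open Summit.KontsevichZagierPeriods.SymplecticScissors.FiniteMapShear (finiteMapShear_proof)

namespace Summit.KontsevichZagierPeriods.SymplecticScissors.MordellWeil

/-! ## Arctangent cells -/

/-- `{q | q i < c}` is `ℚ`-semialgebraic for real algebraic `c`. [folklore] -/
private theorem atan_isSemialgebraic_apply_lt {n : ℕ} {c : ℝ} (hc : IsAlgebraic ℚ c) (i : Fin n) :
    IsSemialgebraic ℚ {q : Fin n → ℝ | q i < c} := by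
  have h1 : IsSemialgebraicFunOn ℚ (univ : Set (Fin n → ℝ)) (fun q => q i) := by
    simpa using isSemialgebraicFunOn_aeval (isSemialgebraic_univ (k := ℚ)) (X i : MvPolynomial (Fin n) ℚ)
  have h := (IsSemialgebraicFunOn.sub_holds h1
    (isSemialgebraicFunOn_const_of_isAlgebraic isSemialgebraic_univ hc)).isSemialgebraic_sep_neg
  convert h using 1
  ext q
  simp [sub_neg]

/-- `{q | c < q i}` is `ℚ`-semialgebraic for real algebraic `c`. [folklore] -/
private theorem atan_isSemialgebraic_lt_apply {n : ℕ} {c : ℝ} (hc : IsAlgebraic ℚ c) (i : Fin n) :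
    IsSemialgebraic ℚ {q : Fin n → ℝ | c < q i} := by
  have h1 : IsSemialgebraicFunOn ℚ (univ : Set (Fin n → ℝ)) (fun q => q i) := by
    simpa using isSemialgebraicFunOn_aeval (isSemialgebraic_univ (k := ℚ)) (X i : MvPolynomial (Fin n) ℚ)
  have h := (IsSemialgebraicFunOn.sub_holds
    (isSemialgebraicFunOn_const_of_isAlgebraic isSemialgebraic_univ hc) h1).isSemialgebraic_sep_neg
  convert h using 1
  ext q
  simp [sub_neg]

/-- The region `{0 < v, (1 + u²) v < 1}` under the graph of `1/(1+u²)` is `ℚ`-semialgebraic.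
[folklore] -/
theorem isSemialgebraic_underArctan :
    IsSemialgebraic ℚ {q : Fin 2 → ℝ | 0 < q 1 ∧ (1 + q 0 ^ 2) * q 1 < 1} := by
  have h := (isSemialgebraic_setOf_eval_lt (k := ℚ) (R := ℝ) (ι := Fin 2) (C 0) (X 1)).inter
    (isSemialgebraic_setOf_eval_lt (k := ℚ) (R := ℝ) (ι := Fin 2) ((1 + X 0 ^ 2) * X 1) (C 1))
  have hEq : {q : Fin 2 → ℝ | 0 < q 1 ∧ (1 + q 0 ^ 2) * q 1 < 1} =
      {x : Fin 2 → ℝ | aeval x (C 0 : MvPolynomial (Fin 2) ℚ) < aeval x (X 1 : MvPolynomial (Fin 2) ℚ)} ∩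
      {x : Fin 2 → ℝ | aeval x ((1 + X 0 ^ 2) * X 1 : MvPolynomial (Fin 2) ℚ) <
        aeval x (C 1 : MvPolynomial (Fin 2) ℚ)} := by
    ext q; simp
  rw [hEq]; exact h

/-- Arctangent cells with algebraic ends are `ℚ`-semialgebraic. [folklore] -/
theorem isSemialgebraic_atanCell {lo hi : ℝ} (hlo : IsAlgebraic ℚ lo) (hhi : IsAlgebraic ℚ hi) :
    IsSemialgebraic ℚ {q : Fin 2 → ℝ | lo < q 0 ∧ q 0 < hi ∧ 0 < q 1 ∧ (1 + q 0 ^ 2) * q 1 < 1} := by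
  have h := ((atan_isSemialgebraic_lt_apply hlo 0).inter
    (atan_isSemialgebraic_apply_lt hhi 0)).inter isSemialgebraic_underArctan
  convert h using 1
  ext q
  simp [and_assoc]

/-- Points with `lo ≤ u ≤ hi`, `0 < v`, `(1 + u²) v < 1` lie in the box `[lo, hi] × [0, 1]`.
[folklore] -/
theorem mem_Icc_of_underArctan {lo hi : ℝ} {q : Fin 2 → ℝ} (h0 : lo ≤ q 0) (h1 : q 0 ≤ hi)
    (h2 : 0 < q 1) (h3 : (1 + q 0 ^ 2) * q 1 < 1) : q ∈ Icc ![lo, 0] ![hi, 1] := by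
  have hq1 : q 1 ≤ 1 := by nlinarith [sq_nonneg (q 0)]
  refine ⟨fun i => ?_, fun i => ?_⟩ <;> fin_cases i <;> simp
  · exact h0
  · exact h2.le
  · exact h1
  · exact hq1

/-- An integrand-`1` representation on an arctangent cell with algebraic ends. [folklore] -/
theorem exists_atanCellRep {lo hi : ℝ} (hlo : IsAlgebraic ℚ lo) (hhi : IsAlgebraic ℚ hi) :
    ∃ r : KZ.IntegralRep 2, r.domain = {q : Fin 2 → ℝ | lo < q 0 ∧ q 0 < hi ∧ 0 < q 1 ∧ (1 + q 0 ^ 2) * q 1 < 1} ∧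
      r.integrand = fun _ => 1 :=
  KZ.exists_oneRep (isSemialgebraic_atanCell hlo hhi)
    ((measure_mono fun _ hq => mem_Icc_of_underArctan hq.1.le hq.2.1.le hq.2.2.1
      hq.2.2.2).trans_lt isCompact_Icc.measure_lt_top).ne

/-- A planar instance of rule (1a) lies in the planar group. [folklore] -/
private theorem atan_mem_planarGroup_of_cut {r r₁ r₂ : KZ.IntegralRep 2}
    (hr : ∀ p ∈ r.domain, r.integrand p = 1) (hr₁ : ∀ p ∈ r₁.domain, r₁.integrand p = 1)
    (hr₂ : ∀ p ∈ r₂.domain, r₂.integrand p = 1)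
    (hunion : r.domain = r₁.domain ∪ r₂.domain) (hnull : volume (r₁.domain ∩ r₂.domain) = 0) :
    KZ.of r - KZ.of r₁ - KZ.of r₂ ∈ planarGroup := by
  refine AddSubgroup.subset_closure ⟨Or.inl ⟨2, r, r₁, r₂, hunion, hnull,
    fun p hp => by rw [hr p (hunion ▸ Or.inl hp), hr₁ p hp],
    fun p hp => by rw [hr p (hunion ▸ Or.inr hp), hr₂ p hp], rfl⟩, ?_⟩
  exact (AddSubgroup.closure planarGens).sub_mem
    ((AddSubgroup.closure planarGens).sub_mem (AddSubgroup.subset_closure ⟨r, hr, rfl⟩)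
      (AddSubgroup.subset_closure ⟨r₁, hr₁, rfl⟩)) (AddSubgroup.subset_closure ⟨r₂, hr₂, rfl⟩)

/-- A planar instance of rule (2) lies in the planar group. [folklore] -/
private theorem atan_mem_planarGroup_of_cov {r r' : KZ.IntegralRep 2}
    (hr : ∀ p ∈ r.domain, r.integrand p = 1) (hr' : ∀ p ∈ r'.domain, r'.integrand p = 1)
    (h : KZ.of r - KZ.of r' ∈ KZ.changeOfVariablesRel) : KZ.of r - KZ.of r' ∈ planarGroup :=
  AddSubgroup.subset_closure ⟨Or.inr h, (AddSubgroup.closure planarGens).sub_mem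
    (AddSubgroup.subset_closure ⟨r, hr, rfl⟩) (AddSubgroup.subset_closure ⟨r', hr', rfl⟩)⟩

/-! ## The Möbius map `M u = (u − β)/(1 + βu)` -/

/-- The Möbius map `M_β u = (u − β)/(1 + βu)` (rotation of the circle by `−arctan β`), as local
notation (no definition is introduced). -/
local notation "mob[" β "]" => (fun u : ℝ => (u - β) / (1 + β * u))

/-- The derivative `M′ u = (1 + β²)/(1 + βu)²` where `1 + βu ≠ 0`. [folklore] -/
theorem hasDerivAt_mob {β u : ℝ} (h : 1 + β * u ≠ 0) :
    HasDerivAt (mob[β]) ((1 + β ^ 2) / (1 + β * u) ^ 2) u := by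
  have hn : HasDerivAt (fun u : ℝ => u - β) 1 u := (hasDerivAt_id u).sub_const β
  have hd : HasDerivAt (fun u : ℝ => 1 + β * u) β u := by
    simpa using ((hasDerivAt_id u).const_mul β).const_add 1
  exact (hn.div hd h).congr_deriv (by ring)

/-- `deriv M` in closed form where `1 + βu ≠ 0`. [folklore] -/
theorem deriv_mob {β u : ℝ} (h : 1 + β * u ≠ 0) :
    deriv (mob[β]) u = (1 + β ^ 2) / (1 + β * u) ^ 2 := (hasDerivAt_mob h).deriv

/-- `M` is smooth where `1 + βu ≠ 0`, in particular on `(lo, hi)` with `0 ≤ lo`, `0 ≤ β`. [folklore] -/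
theorem contDiffOn_mob {β lo hi : ℝ} (hβ : 0 ≤ β) (hlo : 0 ≤ lo) (n : WithTop ℕ∞) :
    ContDiffOn ℝ n (mob[β]) (Ioo lo hi) := by
  refine ContDiffOn.div (contDiffOn_id.sub contDiffOn_const)
    (contDiffOn_const.add (contDiffOn_const.mul contDiffOn_id)) fun u hu => ?_
  have : 0 < 1 + β * u := by nlinarith [hu.1, hlo]
  exact this.ne'

/-- The invariance of `dθ`: `M′ u / (1 + (M u)²) = 1/(1 + u²)`. [folklore] -/
theorem mob_invariance {β u : ℝ} (h : 0 < 1 + β * u) :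
    1 / (1 + ((u - β) / (1 + β * u)) ^ 2) * ((1 + β ^ 2) / (1 + β * u) ^ 2) = 1 / (1 + u ^ 2) := by
  have h0 : (1 + β * u) ≠ 0 := h.ne'
  have h1 : (1 + u ^ 2) ≠ 0 := by positivity
  have h2 : (1 + β ^ 2) ≠ 0 := by positivity
  have h3 : (1 + β * u) ^ 2 ≠ 0 := pow_ne_zero 2 h0
  have key : (1 + β * u) ^ 2 + (u - β) ^ 2 = (1 + β ^ 2) * (1 + u ^ 2) := by ring
  rw [div_pow, one_add_div h3, one_div_div, key, div_mul_div_comm, mul_comm ((1 + β ^ 2) * (1 + u ^ 2)),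
    ← div_mul_div_comm, div_self h3, one_mul, div_mul_cancel_left₀ h2, one_div]

/-- The image of `(β, β ⊕ γ)` under `M_β` is `(0, γ)` (`0 < β`, `0 < γ`, `βγ < 1`). [folklore] -/
theorem image_mob_Ioo {β γ : ℝ} (hβ : 0 < β) (hγ : 0 < γ) (hβγ : β * γ < 1) :
    mob[β] '' Ioo β ((β + γ) / (1 - β * γ)) = Ioo 0 γ := by
  have h1 : 0 < 1 - β * γ := by linarith
  ext t
  simp only [mem_image, mem_Ioo]
  constructor
  · rintro ⟨u, ⟨hu1, hu2⟩, rfl⟩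
    have hd : 0 < 1 + β * u := by nlinarith
    refine ⟨div_pos (by linarith) hd, ?_⟩
    rw [div_lt_iff₀ hd]
    rw [lt_div_iff₀ h1] at hu2
    nlinarith
  · rintro ⟨ht0, ht1⟩
    have hd : 0 < 1 - β * t := by nlinarith
    refine ⟨(t + β) / (1 - β * t), ⟨?_, ?_⟩, ?_⟩
    · rw [lt_div_iff₀ hd]; nlinarith [mul_pos ht0 (mul_pos hβ hβ)]
    · rw [div_lt_div_iff₀ hd h1]
      nlinarith [mul_pos (sub_pos.mpr ht1) (mul_pos hβ hβ), sub_pos.mpr ht1]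
    · have hne : (1 - β * t) ≠ 0 := hd.ne'
      have h2 : (1 + β ^ 2) ≠ 0 := by positivity
      have e1 : (t + β) / (1 - β * t) - β = t * (1 + β ^ 2) / (1 - β * t) := by
        rw [eq_div_iff hne, sub_mul, div_mul_cancel₀ _ hne]; ring
      have e2 : 1 + β * ((t + β) / (1 - β * t)) = (1 + β ^ 2) / (1 - β * t) := by
        rw [eq_div_iff hne, add_mul, one_mul, mul_assoc, div_mul_cancel₀ _ hne]; ring
      rw [e1, e2, div_div_div_cancel_right₀ hne, mul_div_assoc, div_self h2, mul_one]

/-! ## The law -/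

/-- **Stub 3b (rung 0 of the normal form): the addition law of arctangent cells is planar.** For
real algebraic `β, γ > 0` with `βγ < 1` and planar sets on the arctangent cells `A(β)`, `A(γ)`,
`A((β + γ)/(1 − βγ))` (`A(x) = {0 < u < x, 0 < v, (1 + u²) v < 1}`, area `arctan x`):
`[A(β ⊕ γ)] − [A(β)] − [A(γ)] ∈ planarGroup` — one cut at `u = β` (rule 1a, null segment) and
the Möbius `FiniteMapShear` `(u, v) ↦ (M u, v / M′ u)`, `M u = (u − β)/(1 + βu)`. [folklore] -/
theorem stub_arctanCellLaw :
    ∀ (β γ : ℝ), IsAlgebraic ℚ β → IsAlgebraic ℚ γ → 0 < β → 0 < γ → β * γ < 1 →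
      ∀ (rβ rγ rδ : KZ.IntegralRep 2),
        rβ.domain = {q : Fin 2 → ℝ | 0 < q 0 ∧ q 0 < β ∧ 0 < q 1 ∧ (1 + q 0 ^ 2) * q 1 < 1} →
        rγ.domain = {q : Fin 2 → ℝ | 0 < q 0 ∧ q 0 < γ ∧ 0 < q 1 ∧ (1 + q 0 ^ 2) * q 1 < 1} →
        rδ.domain = {q : Fin 2 → ℝ | 0 < q 0 ∧ q 0 < (β + γ) / (1 - β * γ) ∧ 0 < q 1 ∧
          (1 + q 0 ^ 2) * q 1 < 1} →
        (∀ p ∈ rβ.domain, rβ.integrand p = 1) → (∀ p ∈ rγ.domain, rγ.integrand p = 1) →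
        (∀ p ∈ rδ.domain, rδ.integrand p = 1) →
        KZ.of rδ - KZ.of rβ - KZ.of rγ ∈ planarGroup := by
  intro β γ hβ hγ hβ0 hγ0 hβγ rβ rγ rδ hrβ hrγ hrδ hrβ1 hrγ1 hrδ1
  set δ : ℝ := (β + γ) / (1 - β * γ) with hδ
  have h1βγ : 0 < 1 - β * γ := by linarith
  have hδalg : IsAlgebraic ℚ δ := by
    rw [← mem_algebraicClosure_iff] at hβ hγ ⊢
    exact div_mem (add_mem hβ hγ) (sub_mem (one_mem _) (mul_mem hβ hγ))
  have hβδ : β < δ := by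
    rw [hδ, lt_div_iff₀ h1βγ]; nlinarith [mul_pos hγ0 (mul_pos hβ0 hβ0)]
  -- V = A(β, δ), the open right piece; N the null segment u = β; U = N ∪ V
  obtain ⟨V, hVd, hVi⟩ := exists_atanCellRep hβ hδalg
  have hVi' : ∀ p ∈ V.domain, V.integrand p = 1 := fun p _ => by rw [hVi]
  have hNsa : IsSemialgebraic ℚ {q : Fin 2 → ℝ | q 0 = β ∧ 0 < q 1 ∧ (1 + q 0 ^ 2) * q 1 < 1} := by
    have h := (isSemialgebraic_setOf_apply_eq_of_isAlgebraic hβ (0 : Fin 2)).inter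
      isSemialgebraic_underArctan
    convert h using 1
    ext q; simp
  have hNnull : volume {q : Fin 2 → ℝ | q 0 = β ∧ 0 < q 1 ∧ (1 + q 0 ^ 2) * q 1 < 1} = 0 := by
    refine measure_mono_null (fun q hq => ?_)
      (show volume (Set.pi univ (![{β}, univ] : Fin 2 → Set ℝ)) = 0 from ?_)
    · rw [mem_univ_pi]
      intro i
      fin_cases i
      · simpa using hq.1
      · simp
    · rw [volume_pi_pi]
      simp [Fin.prod_univ_two]
  obtain ⟨N, hNd, hNi⟩ := KZ.exists_oneRep hNsa (by rw [hNnull]; exact ENNReal.zero_ne_top)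
  have hNi' : ∀ p ∈ N.domain, N.integrand p = 1 := fun p _ => by rw [hNi]
  have hUsa : IsSemialgebraic ℚ
      {q : Fin 2 → ℝ | β ≤ q 0 ∧ q 0 < δ ∧ 0 < q 1 ∧ (1 + q 0 ^ 2) * q 1 < 1} := by
    have h1 : IsSemialgebraicFunOn ℚ (univ : Set (Fin 2 → ℝ)) (fun q => q 0) := by
      simpa using isSemialgebraicFunOn_aeval (isSemialgebraic_univ (k := ℚ))
        (X 0 : MvPolynomial (Fin 2) ℚ)
    have hge := (IsSemialgebraicFunOn.sub_holds h1
      (isSemialgebraicFunOn_const_of_isAlgebraic isSemialgebraic_univ hβ)).isSemialgebraic_sep_nonneg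
    have h := (hge.inter (atan_isSemialgebraic_apply_lt hδalg 0)).inter isSemialgebraic_underArctan
    convert h using 1
    ext q
    simp [sub_nonneg, and_assoc]
  have hUfin : volume {q : Fin 2 → ℝ | β ≤ q 0 ∧ q 0 < δ ∧ 0 < q 1 ∧ (1 + q 0 ^ 2) * q 1 < 1} ≠ ⊤ :=
    ((measure_mono fun q hq => mem_Icc_of_underArctan hq.1 hq.2.1.le hq.2.2.1
      hq.2.2.2).trans_lt isCompact_Icc.measure_lt_top).ne
  obtain ⟨U, hUd, hUi⟩ := KZ.exists_oneRep hUsa hUfin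
  have hUi' : ∀ p ∈ U.domain, U.integrand p = 1 := fun p _ => by rw [hUi]
  -- (1) cut A(δ) at u = β
  have h1 : KZ.of rδ - KZ.of rβ - KZ.of U ∈ planarGroup := by
    refine atan_mem_planarGroup_of_cut hrδ1 hrβ1 hUi' ?_ ?_
    · rw [hrδ, hrβ, hUd]
      ext q
      simp only [mem_setOf_eq, mem_union]
      constructor
      · rintro ⟨hq1, hq2, hq3, hq4⟩
        rcases lt_or_ge (q 0) β with h | h
        · exact Or.inl ⟨hq1, h, hq3, hq4⟩
        · exact Or.inr ⟨h, hq2, hq3, hq4⟩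
      · rintro (⟨hq1, hq2, hq3, hq4⟩ | ⟨hq1, hq2, hq3, hq4⟩)
        · exact ⟨hq1, hq2.trans hβδ, hq3, hq4⟩
        · exact ⟨hβ0.trans_le hq1, hq2, hq3, hq4⟩
    · rw [hrβ, hUd]
      have he : {q : Fin 2 → ℝ | 0 < q 0 ∧ q 0 < β ∧ 0 < q 1 ∧ (1 + q 0 ^ 2) * q 1 < 1} ∩
          {q | β ≤ q 0 ∧ q 0 < δ ∧ 0 < q 1 ∧ (1 + q 0 ^ 2) * q 1 < 1} = ∅ := by
        ext q
        simp only [mem_inter_iff, mem_setOf_eq, mem_empty_iff_false, iff_false]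
        rintro ⟨⟨-, h, -, -⟩, h', -, -, -⟩
        linarith
      rw [he, measure_empty]
  -- (2) U = N ∪ V
  have h2 : KZ.of U - KZ.of N - KZ.of V ∈ planarGroup := by
    refine atan_mem_planarGroup_of_cut hUi' hNi' hVi' ?_ ?_
    · rw [hUd, hNd, hVd]
      ext q
      simp only [mem_setOf_eq, mem_union, mem_setOf_eq]
      constructor
      · rintro ⟨hq1, hq2, hq3, hq4⟩
        rcases hq1.lt_or_eq with h | h
        · exact Or.inr ⟨h, hq2, hq3, hq4⟩
        · exact Or.inl ⟨h.symm, hq3, hq4⟩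
      · rintro (⟨hq1, hq3, hq4⟩ | ⟨hq1, hq2, hq3, hq4⟩)
        · exact ⟨hq1.ge, hq1 ▸ hβδ, hq3, hq4⟩
        · exact ⟨hq1.le, hq2, hq3, hq4⟩
    · rw [hNd, hVd]
      have he : {q : Fin 2 → ℝ | q 0 = β ∧ 0 < q 1 ∧ (1 + q 0 ^ 2) * q 1 < 1} ∩
          {q : Fin 2 → ℝ | β < q 0 ∧ q 0 < δ ∧ 0 < q 1 ∧ (1 + q 0 ^ 2) * q 1 < 1} = ∅ := by
        ext q
        simp only [mem_inter_iff, mem_setOf_eq, mem_setOf_eq, mem_empty_iff_false, iff_false]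
        rintro ⟨⟨h, -, -⟩, h', -, -, -⟩
        linarith
      rw [he, measure_empty]
  -- (3) N is null
  have h3 : KZ.of N ∈ planarGroup :=
    of_mem_planarGroup_of_volume_eq_zero N hNi' (by rw [hNd, hNnull])
  -- (4) the Möbius shear carries V onto A(γ) = rγ.domain (support FiniteMapShear)
  have hpos1 : ∀ u ∈ Ioo β δ, 0 < 1 + β * u := fun u hu => by nlinarith [hu.1]
  have hstrip : IsSemialgebraic ℚ {z : Fin 1 → ℝ | z 0 ∈ Ioo β δ} := by
    have h := (atan_isSemialgebraic_lt_apply hβ (0 : Fin 1)).inter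
      (atan_isSemialgebraic_apply_lt hδalg (0 : Fin 1))
    have hEq : {z : Fin 1 → ℝ | z 0 ∈ Ioo β δ} = {q : Fin 1 → ℝ | β < q 0} ∩ {q | q 0 < δ} := by
      ext z; simp
    rw [hEq]; exact h
  have hφ : IsSemialgebraicFunOn ℚ {z : Fin 1 → ℝ | z 0 ∈ Ioo β δ} (fun z => (z 0 - β) / (1 + β * z 0)) := by
    have h1 : IsSemialgebraicFunOn ℚ {z : Fin 1 → ℝ | z 0 ∈ Ioo β δ} (fun z => z 0) := by
      simpa using isSemialgebraicFunOn_aeval hstrip (X 0 : MvPolynomial (Fin 1) ℚ)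
    have hc := isSemialgebraicFunOn_const_of_isAlgebraic hstrip hβ
    have h1' := isSemialgebraicFunOn_const_of_isAlgebraic hstrip isAlgebraic_one
    exact IsSemialgebraicFunOn.div (IsSemialgebraicFunOn.sub_holds h1 hc)
      (IsSemialgebraicFunOn.add_holds h1' (IsSemialgebraicFunOn.mul_holds hc h1))
      fun z hz => (hpos1 _ hz).ne'
  have hφ' : IsSemialgebraicFunOn ℚ {z : Fin 1 → ℝ | z 0 ∈ Ioo β δ}
      (fun z => deriv (mob[β]) (z 0)) := by
    have h1 : IsSemialgebraicFunOn ℚ {z : Fin 1 → ℝ | z 0 ∈ Ioo β δ} (fun z => z 0) := by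
      simpa using isSemialgebraicFunOn_aeval hstrip (X 0 : MvPolynomial (Fin 1) ℚ)
    have hc := isSemialgebraicFunOn_const_of_isAlgebraic hstrip hβ
    have h1' := isSemialgebraicFunOn_const_of_isAlgebraic hstrip isAlgebraic_one
    have hnum := isSemialgebraicFunOn_const_of_isAlgebraic hstrip
      (show IsAlgebraic ℚ (1 + β ^ 2) from by
        rw [← mem_algebraicClosure_iff] at hβ ⊢
        exact add_mem (one_mem _) (pow_mem hβ 2))
    have hden := IsSemialgebraicFunOn.add_holds h1' (IsSemialgebraicFunOn.mul_holds hc h1)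
    refine (IsSemialgebraicFunOn.div hnum (IsSemialgebraicFunOn.mul_holds hden hden)
      fun z hz => ?_).congr fun z hz => ?_
    · exact mul_ne_zero (hpos1 _ hz).ne' (hpos1 _ hz).ne'
    · show (1 + β ^ 2) / ((1 + β * z 0) * (1 + β * z 0)) = deriv (mob[β]) (z 0)
      rw [deriv_mob (hpos1 _ hz).ne']
      ring
  have hC2 : ContDiffOn ℝ 2 (mob[β]) (Ioo β δ) := contDiffOn_mob hβ0.le hβ0.le 2
  have hder : ∀ u ∈ Ioo β δ, 0 < deriv (mob[β]) u := fun u hu => by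
    rw [deriv_mob (hpos1 u hu).ne']
    exact div_pos (by positivity) (pow_pos (hpos1 u hu) 2)
  have himage : mob[β] '' Ioo β δ = Ioo 0 γ := image_mob_Ioo hβ0 hγ0 hβγ
  have hw : IsSemialgebraicFunOn ℚ {z : Fin 1 → ℝ | z 0 ∈ mob[β] '' Ioo β δ}
      (fun z => 1 / (1 + z 0 ^ 2)) := by
    rw [himage]
    have hs : IsSemialgebraic ℚ {z : Fin 1 → ℝ | z 0 ∈ Ioo (0 : ℝ) γ} := by
      have h := (atan_isSemialgebraic_lt_apply (isAlgebraic_zero (R := ℚ) (A := ℝ)) (0 : Fin 1)).inter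
        (atan_isSemialgebraic_apply_lt hγ (0 : Fin 1))
      have hEq : {z : Fin 1 → ℝ | z 0 ∈ Ioo (0 : ℝ) γ} = {q : Fin 1 → ℝ | 0 < q 0} ∩ {q | q 0 < γ} := by
        ext z; simp
      rw [hEq]; exact h
    refine (IsSemialgebraicFunOn.div (isSemialgebraicFunOn_const_of_isAlgebraic hs isAlgebraic_one)
      ((isSemialgebraicFunOn_aeval hs (1 + X 0 ^ 2 : MvPolynomial (Fin 1) ℚ)).congr
        fun z _ => by simp) fun z _ => ?_)
    positivity
  have h4 : KZ.of V - KZ.of rγ ∈ planarGroup := by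
    refine atan_mem_planarGroup_of_cov hVi' hrγ1 (finiteMapShear_proof β δ (mob[β])
      (fun u => 1 / (1 + u ^ 2)) hβδ hφ hφ' hC2 hder hw V rγ ?_ ?_ hVi' hrγ1)
    · rw [hVd]
      ext p
      simp only [mem_setOf_eq, mem_setOf_eq, mem_Ioo]
      constructor
      · rintro ⟨hp1, hp2, hp3, hp4⟩
        refine ⟨⟨hp1, hp2⟩, hp3, ?_⟩
        rw [deriv_mob (hpos1 _ ⟨hp1, hp2⟩).ne', mob_invariance (hpos1 _ ⟨hp1, hp2⟩),
          lt_div_iff₀ (by positivity)]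
        linarith [mul_comm (1 + p 0 ^ 2) (p 1)]
      · rintro ⟨⟨hp1, hp2⟩, hp3, hp4⟩
        refine ⟨hp1, hp2, hp3, ?_⟩
        rw [deriv_mob (hpos1 _ ⟨hp1, hp2⟩).ne', mob_invariance (hpos1 _ ⟨hp1, hp2⟩),
          lt_div_iff₀ (by positivity)] at hp4
        linarith [mul_comm (1 + p 0 ^ 2) (p 1)]
    · rw [hrγ, himage]
      ext q
      simp only [mem_setOf_eq, mem_Ioo]
      constructor
      · rintro ⟨hq1, hq2, hq3, hq4⟩
        refine ⟨⟨hq1, hq2⟩, hq3, ?_⟩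
        rw [lt_div_iff₀ (by positivity)]
        linarith [mul_comm (1 + q 0 ^ 2) (q 1)]
      · rintro ⟨⟨hq1, hq2⟩, hq3, hq4⟩
        refine ⟨hq1, hq2, hq3, ?_⟩
        rw [lt_div_iff₀ (by positivity)] at hq4
        linarith [mul_comm (1 + q 0 ^ 2) (q 1)]
  have h12 := planarGroup.add_mem (planarGroup.add_mem (planarGroup.add_mem h1 h2) h3) h4
  convert h12 using 1
  abel

end Summit.KontsevichZagierPeriods.SymplecticScissors.MordellWeil

end
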